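import Mathlib
import Summits.CriticalPhenomena.Ising3DConformalLimit.Theses.GaussianScaleMixture

/-!
# Sketch — crux-ideate stmt-CriticalPhenomena-8367 (Theses.GaussianScaleMixture.RotationUpgradeFromTwoPoint),
# round 1, ideator 1

First lemmas of the two crux idea cards

* `rp-lebowitz-anisotropy-bootstrap` (Card A): the model-blind-WITH-nine-RP-and-Ising-signs
  strengthening `MB9plus` of the crux, its reduction to the crux (`reduction`, proved), and the
  even two-cluster Osterwalder–Schrader Gram condition that seeds the semidefinite programme.
* `null-laplacian-edge-gaussianity` (Card B): at the edge `Δ = 1/2` the round two-point kernel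
  is harmonic, the OS vector `[ΔZ(x)]` is null in all nine lattice pictures, every `S(·, Y)` is
  harmonic off the `B₃`-hull of `Y`, the nine pictures make it real-analytic off a finite set,
  and the limit is the massless Gaussian free field (`EdgeGaussianity`), hence isotropic.

Nothing here needs to be proved (crux-ideate); everything must elaborate.  `reduction` and
`crux_iff` are proved (pure logic).
-/

namespace Summit.CriticalPhenomena.Ising3DConformalLimit.Cruxes.RotationUpgradeFromTwoPoint.Ideator1

open Literature.Probability.LatticeModels

/-- Points of `ℝ³`. -/
abbrev E3 : Type := EuclideanSpace ℝ (Fin 3)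

/-! ## The crux hypotheses, verbatim -/

/-- The seven hypotheses of `Theses.GaussianScaleMixture.RotationUpgradeFromTwoPoint`, bundled. -/
def CruxHyp (ρ : ℝ → ℝ) (Δ : ℝ) (S : CorrFamily 3) : Prop :=
  (∀ δ ∈ Set.Ioc (0:ℝ) 1, 0 < ρ δ) ∧
  HasPointwiseScalingLimit (criticalCorr 3) ρ S ∧
  (∀ n z, z ∉ NonCoincident 3 n → S n z = 0) ∧
  IsNondegenerateTwoPoint S ∧
  IsTranslationInvariant S ∧
  IsScaleCovariant Δ S ∧
  (∀ (R : E3 ≃ₗᵢ[ℝ] E3) (x : E3), x ≠ 0 → S 2 ![0, R x] = S 2 ![0, x])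

/-- The crux is `∀ ρ Δ S, CruxHyp ρ Δ S → IsRotationInvariant S` (pure currying). -/
theorem crux_iff :
    Theses.GaussianScaleMixture.RotationUpgradeFromTwoPoint ↔
      ∀ ρ Δ S, CruxHyp ρ Δ S → IsRotationInvariant S := by
  constructor
  · rintro h ρ Δ S ⟨h1, h2, h3, h4, h5, h6, h7⟩
    exact h ρ Δ S h1 h2 h3 h4 h5 h6 h7
  · intro h ρ Δ S h1 h2 h3 h4 h5 h6 h7
    exact h ρ Δ S ⟨h1, h2, h3, h4, h5, h6, h7⟩

/-! ## Shared vocabulary: the nine lattice mirrors, `O_h`, nine-direction RP, hafnians -/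

/-- The nine lattice mirror normals `eᵢ`, `eᵢ + eⱼ`, `eᵢ - eⱼ` (`i ≠ j`), as in
`GaussianScaleMixture.GSMRigidity` / `TwoPointKernelOfLimit`. -/
def IsLatticeNormal (n : E3) : Prop :=
  ∃ i j : Fin 3, i ≠ j ∧ (n = EuclideanSpace.single i 1 ∨
    n = EuclideanSpace.single i 1 + EuclideanSpace.single j 1 ∨
    n = EuclideanSpace.single i 1 - EuclideanSpace.single j 1)

/-- Signed permutation matrices = the hyperoctahedral group `O_h = B₃` (order 48). -/
def IsSignedPermutation (R : E3 ≃ₗᵢ[ℝ] E3) : Prop :=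
  ∀ i : Fin 3, ∃ j : Fin 3, R (EuclideanSpace.single i 1) = EuclideanSpace.single j 1 ∨
    R (EuclideanSpace.single i 1) = -EuclideanSpace.single j 1

/-- `O_h`-invariance of all `n`-point functions (lattice symmetry passed to the limit). -/
def OhInvariant (S : CorrFamily 3) : Prop :=
  ∀ R : E3 ≃ₗᵢ[ℝ] E3, IsSignedPermutation R →
    ∀ n (x : Fin n → E3), S n (fun i => R (x i)) = S n x

/-- Nine-direction reflection positivity of the WHOLE family (Osterwalder–Schrader positivity in
each of the nine lattice pictures, all offsets by translation invariance): for clusters `A_a` of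
arbitrary sizes in the open positive half-space of a lattice normal `n` and real coefficients
`c_a`, the Gram sum `Σ c_a c_b S(θ_n A_a ⊔ A_b)` is non-negative.  (The two-point truncation is
the last hypothesis block of `TwoPointKernelOfLimit`.) -/
def NineRP (S : CorrFamily 3) : Prop :=
  ∀ n : E3, IsLatticeNormal n →
    ∀ (k : ℕ) (m : Fin k → ℕ) (A : (a : Fin k) → Fin (m a) → E3) (c : Fin k → ℝ),
      (∀ a i, 0 < inner ℝ (A a i) n) →
      0 ≤ ∑ a, ∑ b, c a * c b *
        S (m a + m b) (Fin.append (fun i => ((ℝ ∙ n)ᗮ).reflection (A a i)) (A b))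

/-- The hafnian (sum over pairings) built from the two-point function of `S`:
`haf S m x = Σ_{pairings π of 2m points} Π_{{i,j} ∈ π} S₂(xᵢ,xⱼ)`, written as a sum over all
permutations divided by the `2^m m!`-fold overcount. -/
noncomputable def haf (S : CorrFamily 3) (m : ℕ) (x : Fin (m * 2) → E3) : ℝ :=
  (∑ σ : Equiv.Perm (Fin (m * 2)), ∏ i : Fin m,
      S 2 ![x (σ (finProdFinEquiv (i, (0 : Fin 2)))), x (σ (finProdFinEquiv (i, (1 : Fin 2))))])
    / (2 ^ m * (m.factorial : ℝ))

/-- Newman's Gaussian inequality `S_{2m} ≤ Σ_pairings Π S₂` (Lee–Yang; `Newman1975Gaussian`),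
which passes to pointwise limits. -/
def NewmanBound (S : CorrFamily 3) : Prop :=
  ∀ m (x : Fin (m * 2) → E3), x ∈ NonCoincident 3 (m * 2) → S (m * 2) x ≤ haf S m x

/-- The "Ising signs" used model-blindly: positivity, odd correlations vanish, GKS-II at the
four-point level (`S₂S₂ ≤ S₄`), Newman's Gaussian upper bound (which at `n = 4` is Lebowitz
`U₄ ≤ 0`). -/
def IsingSigns (S : CorrFamily 3) : Prop :=
  (∀ n x, 0 ≤ S n x) ∧
  (∀ m (x : Fin (2 * m + 1) → E3), S (2 * m + 1) x = 0) ∧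
  (∀ x : Fin 4 → E3, x ∈ NonCoincident 3 4 → S 2 ![x 0, x 1] * S 2 ![x 2, x 3] ≤ S 4 x) ∧
  NewmanBound S

/-! ## Card A `rp-lebowitz-anisotropy-bootstrap` -/

/-- **MB9⁺** — the model-blind-WITH-RP strengthening of the crux (the crux's lattice object
`criticalCorr 3` replaced by the axioms its limits are known or expected to satisfy): every
`O_h`-symmetric, translation-invariant, scale-covariant (`1/2 ≤ Δ ≤ 1`), nine-direction
reflection-positive family, normalised off `NonCoincident` and continuous on it, with EXACTLY
ROUND two-point function `c‖x-y‖^{-2Δ}` and the Ising signs, is `O(3)`-invariant.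
The refuters' open question "round `S₂` + `B₃`-invariant `S_{n≥3}` is excluded by no known
argument", made a closed convex-duality statement: nine-RP ∩ signs is a convex cone in `S`,
the round law is an affine slice, the conclusion is linear. -/
def MB9plus : Prop :=
  ∀ (S : CorrFamily 3) (Δ c : ℝ),
    NineRP S → OhInvariant S → IsTranslationInvariant S → IsScaleCovariant Δ S →
    1 / 2 ≤ Δ → Δ ≤ 1 → 0 < c →
    (∀ n z, z ∉ NonCoincident 3 n → S n z = 0) →
    (∀ n, ContinuousOn (S n) (NonCoincident 3 n)) →
    (∀ x y : E3, x ≠ y → S 2 ![x, y] = c * ‖x - y‖ ^ (-(2 * Δ))) →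
    IsingSigns S →
    IsRotationInvariant S

/-- The passage facts (each provable now or filed elsewhere as support): crux hypotheses ⇒ the
axioms of `MB9plus` — nine-mirror RP of the limit (FILS site/diagonal-plane RP of the n.n.
ferromagnet, closed under pointwise limits), `O_h`-invariance of normalised limits, the window
`Δ ∈ [1/2,1]` (`scalingDimension_mem_Icc_holds`), the round law with one constant `c` (two-point
isotropy + scale covariance + translations), continuity on `NonCoincident`, and the Ising signs
(GKS, Newman, odd vanishing — all closed conditions). -/
def PassageFacts : Prop :=
  ∀ ρ Δ S, CruxHyp ρ Δ S →
    NineRP S ∧ OhInvariant S ∧ (1 / 2 ≤ Δ ∧ Δ ≤ 1) ∧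
    (∃ c : ℝ, 0 < c ∧ ∀ x y : E3, x ≠ y → S 2 ![x, y] = c * ‖x - y‖ ^ (-(2 * Δ))) ∧
    (∀ n, ContinuousOn (S n) (NonCoincident 3 n)) ∧ IsingSigns S

/-- **Reduction** (proved): `MB9⁺` together with the passage facts decides the crux. -/
theorem reduction (hMB : MB9plus) (hP : PassageFacts) :
    Theses.GaussianScaleMixture.RotationUpgradeFromTwoPoint := by
  rw [crux_iff]
  intro ρ Δ S hS
  obtain ⟨hRP, hOh, ⟨hlo, hhi⟩, ⟨c, hc, hround⟩, hcont, hsigns⟩ := hP ρ Δ S hS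
  obtain ⟨_, _, hnorm, _, htr, hsc, _⟩ := hS
  exact hMB S Δ c hRP hOh htr hsc hlo hhi hc hnorm hcont hround hsigns

/-- The even two-cluster Gram condition, the first SDP block: for two-point clusters
`A_a = {a, a'}` in the open half-space of a lattice normal `n`, the vacuum-subtracted matrix
`S₄(θA_a ⊔ A_b) - S₂(A_a) S₂(A_b)` is positive semidefinite (OS positivity on `span{1, ZZ}`).
With the ROUND `S₂` this is an AFFINE matrix inequality in the unknown `S₄` — the reason the
round law, and not merely scale covariance, is what makes the anisotropy programme a semidefinite
one (without it the constraint set is a cone with a free rescaling and anisotropy is unpinned). -/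
def EvenTwoClusterGram : Prop :=
  ∀ ρ Δ S, CruxHyp ρ Δ S →
    ∀ n : E3, IsLatticeNormal n →
      ∀ (k : ℕ) (A : Fin k → Fin 2 → E3) (c : Fin k → ℝ), (∀ a i, 0 < inner ℝ (A a i) n) →
        0 ≤ ∑ a, ∑ b, c a * c b *
          (S 4 (Fin.append (fun i => ((ℝ ∙ n)ᗮ).reflection (A a i)) (A b))
            - S 2 ![A a 0, A a 1] * S 2 ![A b 0, A b 1])

/-- Weak duality, the shape of every certificate the programme can return: a linear functional
`L` on four-point data that is non-positive on the whole MB9⁺ class bounds the anisotropy of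
every Ising limit of the crux by `0`.  Instance aimed at: `L(S) = S₄(R X₀) - S₄(X₀)` for a fixed
shape `X₀` and a fixed rotation `R ∉ O_h` (both signs), i.e. one rotation orbit at a time. -/
def CertificateShape : Prop :=
  ∀ (L : CorrFamily 3 → ℝ),
    (∀ (S : CorrFamily 3) (Δ c : ℝ), NineRP S → OhInvariant S → IsTranslationInvariant S →
      IsScaleCovariant Δ S → 1 / 2 ≤ Δ → Δ ≤ 1 → 0 < c →
      (∀ x y : E3, x ≠ y → S 2 ![x, y] = c * ‖x - y‖ ^ (-(2 * Δ))) → IsingSigns S → L S ≤ 0) →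
    PassageFacts → ∀ ρ Δ S, CruxHyp ρ Δ S → L S ≤ 0

/-- `CertificateShape` holds (pure logic). -/
theorem certificateShape_holds : CertificateShape := by
  intro L hL hP ρ Δ S hS
  obtain ⟨hRP, hOh, ⟨hlo, hhi⟩, ⟨c, hc, hround⟩, _, hsigns⟩ := hP ρ Δ S hS
  obtain ⟨_, _, _, _, htr, hsc, _⟩ := hS
  exact hL S Δ c hRP hOh htr hsc hlo hhi hc hround hsigns

/-! ## Card B `null-laplacian-edge-gaussianity` -/

/-- `x` lies outside the `B₃`-hull of the configuration `y`: some lattice mirror family separates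
`x` strictly from all of `y`. -/
def OutsideHull {m : ℕ} (y : Fin m → E3) (x : E3) : Prop :=
  ∃ n : E3, IsLatticeNormal n ∧
    ((∀ i, inner ℝ x n < inner ℝ (y i) n) ∨ (∀ i, inner ℝ (y i) n < inner ℝ x n))

/-- **Exterior harmonicity** (Step 1 of the lever).  At `Δ = 1/2` the round kernel `c‖x‖⁻¹` is
harmonic off `0`, so in every lattice picture the Osterwalder–Schrader vector `[(ΔZ)(x)]` has norm
`Δ_x Δ_{x'} c‖θx' - x‖⁻¹ |_{x'=x} = 0`; pairing the null vector with `[∏ Z(yᵢ)]` gives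
`Δ_x S_{m+1}(x, Y) = 0` whenever a lattice mirror separates `x` from `Y`. -/
def ExteriorHarmonicity : Prop :=
  ∀ ρ Δ S, CruxHyp ρ Δ S → Δ = 1 / 2 →
    ∀ (m : ℕ) (y : Fin m → E3), Function.Injective y →
      ∀ x : E3, OutsideHull y x →
        Laplacian.laplacian (fun x' : E3 => S (m + 1) (Fin.cons x' y)) x = 0

/-- **Nine-picture analyticity off a finite set** (Step 2, valid for EVERY `Δ`; the reusable
regularity layer).  Along a lattice direction `n` that is "good at `x`" (`n·x ∉ {n·yᵢ}`) the map
`t ↦ S(x + t n, Y)` is real-analytic (two-cluster OS semigroup analyticity + translation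
invariance + Bernstein's separate-analyticity theorem in the two variables "shift x" / "shift the
upper cluster"); any five of the nine normals span `ℝ³`, so at most finitely many `x` have fewer
than three independent good directions; the cross theorem (Bernstein–Siciak) then gives joint
real-analyticity of `S(·, Y)` off `Y ∪ F`, `F` finite. -/
def NinePictureAnalyticOffFinite : Prop :=
  ∀ ρ Δ S, CruxHyp ρ Δ S →
    ∀ (m : ℕ) (y : Fin m → E3), Function.Injective y →
      ∃ F : Finset E3,
        AnalyticOnNhd ℝ (fun x : E3 => S (m + 1) (Fin.cons x y)) (Set.range y ∪ (F : Set E3))ᶜ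

/-- **Edge: `U₄` vanishes** (the card's FIRST LEMMA, the `m = 2` case of `EdgeGaussianity`, and all
that is needed): Steps 1–2 make `x ↦ S₄(x, y₁, y₂, y₃)` harmonic on `ℝ³ ∖ {y₁,y₂,y₃}`; the limit
Lebowitz bound `S₄ ≤ Wick₄` (tree `limitConnectedFour_nonpos_of_hasPointwiseScalingLimit`) makes
each `yᵢ` at most a monopole (Bôcher) and, together with GKS-II below, PINS the residue at `yᵢ`
to the Wick residue `c²‖yⱼ-y_k‖⁻¹` (both bounds share that pole); so `U₄(·,Y) = S₄ - Wick₄` is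
harmonic on `ℝ³ ∖ Y` with bounded (removable) singularities and tends to `0` at infinity
(`|U₄| ≤ Wick₄`): `U₄ ≡ 0` by Liouville. -/
def EdgeU4Vanishes : Prop :=
  ∀ ρ Δ S, CruxHyp ρ Δ S → Δ = 1 / 2 → ∀ z ∈ NonCoincident 3 4, limitConnectedFour S z = 0

/-- **Edge Gaussianity** (all orders; follows from `EdgeU4Vanishes` by the tree's Aizenman–Newman
Wick dichotomy `HasPointwiseScalingLimit.eq_pairingSum_of_limitConnectedFour_eq_zero`): an Ising
limit of the crux with `Δ = 1/2` is the massless Gaussian free field — all correlations are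
hafnians of the round two-point function. -/
def EdgeGaussianity : Prop :=
  ∀ ρ Δ S, CruxHyp ρ Δ S → Δ = 1 / 2 →
    ∀ (m : ℕ) (x : Fin (m * 2) → E3), x ∈ NonCoincident 3 (m * 2) → S (m * 2) x = haf S m x

/-- The Gaussian alternative of the crux, as proved by the standing disprover
(`Cruxes/RotationUpgradeFromTwoPoint/Disproof.lean`, `isRotationInvariant_of_gaussian`, rc 0, no
sorry): `U₄ ≡ 0` on non-coincident quadruples ⇒ all `S_{2m}` are Wick sums of the round `S₂` ⇒
`O(3)`.  Restated here over `CruxHyp` so that the composition below is self-contained. -/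
def GaussianAlternative : Prop :=
  ∀ ρ Δ S, CruxHyp ρ Δ S → (∀ z ∈ NonCoincident 3 4, limitConnectedFour S z = 0) →
    IsRotationInvariant S

/-- The crux in the edge case, and the dichotomy it yields for the route: `Δ = 1/2` forces
isotropy AND Gaussianity (so on this route, where item (E) asserts `U₄ ≢ 0`, every other line may
assume `Δ > 1/2`, i.e. a solid one-particle spectral cone). -/
def EdgeCase : Prop :=
  ∀ ρ Δ S, CruxHyp ρ Δ S → Δ = 1 / 2 → IsRotationInvariant S ∧ ¬ HasNontrivialU4 S

/-- Composition (proved): the first lemma plus the disprover's Gaussian alternative settle the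
edge case of the crux. -/
theorem edgeCase_of (hE : EdgeU4Vanishes) (hG : GaussianAlternative) : EdgeCase := by
  intro ρ Δ S hS hΔ
  have hU := hE ρ Δ S hS hΔ
  refine ⟨hG ρ Δ S hS hU, ?_⟩
  rintro ⟨z, hz, hne⟩
  exact hne (hU z hz)

/-- "Interaction forces an anomalous dimension" — the contrapositive dividend, a statement about
3D Ising with no rotation in it: a round, non-Gaussian limit has `η = 2Δ - 1 > 0`. -/
def NonGaussianForcesEta : Prop :=
  ∀ ρ Δ S, CruxHyp ρ Δ S → HasNontrivialU4 S → 1 / 2 < Δ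

end Summit.CriticalPhenomena.Ising3DConformalLimit.Cruxes.RotationUpgradeFromTwoPoint.Ideator1
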